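import Mathlib
import HarnessLib
import Literature.MathematicalPhysics.QuantumLattice.KohnLuttinger
import Summits.HubbardSuperconductivity.HubbardSuperconductivity.Theses.ChiralWindow
import Summits.HubbardSuperconductivity.HubbardSuperconductivity.Theorems.ChiralWindowCwChannelInfContinuousFilling

/-!
# Route `ChiralWindow`, support `CwChannelInfContinuous` (item `stmt-HubbardSuperconductivity-1744`):
the chemical potential of a density, and the reduction to `μ`-continuity

Continuing `ChiralWindowCwChannelInfContinuousFilling`: with `ε = squareDispersion 1 0`,

* `three_div_four_lt_filling_zero` — `3/4 < filling ε 0` (the open diamond `|k₀| + |k₁| < π`, the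
  image of the square `(-π/2, π/2)²` under `(u, v) ↦ (u + v, u - v)`, has volume `2π²` and lies in
  the Fermi sea `{ε < 0}`);
* `filling_chemicalPotentialOfDensity`, `chemicalPotentialOfDensity_mem_Ioo` — for
  `0 < n < filling ε 0` the `sInf` defining `μ(n) = chemicalPotentialOfDensity ε n` is a genuine
  inverse: `μ(n) ∈ (-4, 0)` and `filling ε (μ(n)) = n`;
* `continuousOn_chemicalPotentialOfDensity` — `n ↦ μ(n)` is continuous on `(0, filling ε 0)`;
* `cwChannelInfContinuous_of_continuousOn` — **reduction**: the item `CwChannelInfContinuous`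
  follows from continuity of `μ ↦ channelInf ε μ U χ` on the open band interval `(-4, 0)`.

No new definitions. [folklore]
-/

noncomputable section

open MeasureTheory Real Set Filter Topology
open scoped ENNReal

-- the tree's namespace `Summit.<Summit>.<Problem>.Theorems` repeats the summit name by design (D-0017)
set_option linter.dupNamespace false

namespace Summit.HubbardSuperconductivity.HubbardSuperconductivity.Theorems

open Literature.MathematicalPhysics.QuantumLattice

/-! ### The Fermi sea at `μ = 0` contains the open diamond -/

/-- The open square `(-π/2, π/2)²` has volume `π²`. [folklore] -/
theorem volume_halfOpenSquare :
    volume {p : Momentum | ∀ i, p i ∈ Ioo (-(π / 2)) (π / 2)} = ENNReal.ofReal (π ^ 2) := by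
  have hpre : {p : Momentum | ∀ i, p i ∈ Ioo (-(π / 2)) (π / 2)} =
      (WithLp.ofLp : Momentum → (Fin 2 → ℝ)) ⁻¹' Set.pi univ fun _ => Ioo (-(π / 2)) (π / 2) := by
    ext p; simp
  rw [hpre, (PiLp.volume_preserving_ofLp (Fin 2)).measure_preimage
    (MeasurableSet.univ_pi fun _ => measurableSet_Ioo).nullMeasurableSet, Real.volume_pi_Ioo]
  simp only [Finset.prod_const, Finset.card_univ, Fintype.card_fin]
  rw [← ENNReal.ofReal_pow (by linarith [Real.pi_pos])]
  congr 1
  ring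

/-- The shear `(u, v) ↦ (u + v, u - v)` of momentum space, as a linear map conjugate to the matrix
`!![1, 1; 1, -1]` acting on `Fin 2 → ℝ`. Its determinant is `-2`. [folklore] -/
theorem det_shear :
    LinearMap.det (((WithLp.linearEquiv 2 ℝ (Fin 2 → ℝ)).symm : (Fin 2 → ℝ) →ₗ[ℝ] Momentum) ∘ₗ
      Matrix.toLin' !![(1 : ℝ), 1; 1, -1] ∘ₗ
        ((WithLp.linearEquiv 2 ℝ (Fin 2 → ℝ)) : Momentum →ₗ[ℝ] (Fin 2 → ℝ))) = -2 := by
  have h := LinearMap.det_conj (Matrix.toLin' !![(1 : ℝ), 1; 1, -1])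
    (WithLp.linearEquiv 2 ℝ (Fin 2 → ℝ)).symm
  simp only [LinearEquiv.symm_symm] at h
  rw [h, LinearMap.det_toLin', Matrix.det_fin_two_of]
  norm_num

/-- **`3/4 < filling ε 0`**: the Fermi sea at `μ = 0` contains the open diamond `|k₀| + |k₁| < π`
(on which `cos k₀ + cos k₁ = 2 cos((k₀+k₁)/2) cos((k₀-k₁)/2) > 0`), the image of the square
`(-π/2, π/2)²` under the shear of determinant `-2`, of volume `2π² > (3/4)·(2π)²/2`. [folklore] -/
theorem three_div_four_lt_filling_zero :
    3 / 4 < KohnLuttinger.filling (squareDispersion 1 0) 0 := by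
  rw [filling_eq]
  set L : Momentum →ₗ[ℝ] Momentum :=
    ((WithLp.linearEquiv 2 ℝ (Fin 2 → ℝ)).symm : (Fin 2 → ℝ) →ₗ[ℝ] Momentum) ∘ₗ
      Matrix.toLin' !![(1 : ℝ), 1; 1, -1] ∘ₗ
        ((WithLp.linearEquiv 2 ℝ (Fin 2 → ℝ)) : Momentum →ₗ[ℝ] (Fin 2 → ℝ)) with hL
  set S : Set Momentum := {p : Momentum | ∀ i, p i ∈ Ioo (-(π / 2)) (π / 2)} with hS
  have hLapply : ∀ p : Momentum, (L p) 0 = p 0 + p 1 ∧ (L p) 1 = p 0 - p 1 := by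
    intro p
    simp [hL, Matrix.toLin'_apply, dotProduct, Fin.sum_univ_two,
      Matrix.cons_val_zero, Matrix.cons_val_one, sub_eq_add_neg]
  -- the diamond lies in the Fermi sea at `μ = 0`
  have hsub : L '' S ⊆ brillouinZone ∩ {p : Momentum | squareDispersion 1 0 p < 0} := by
    rintro _ ⟨p, hp, rfl⟩
    have h0 := hp 0; have h1 := hp 1
    obtain ⟨hx, hy⟩ := hLapply p
    refine ⟨fun i => ?_, ?_⟩
    · fin_cases i
      · show (L p) 0 ∈ Ico (-π) π
        rw [hx]; constructor <;> linarith [h0.1, h0.2, h1.1, h1.2]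
      · show (L p) 1 ∈ Ico (-π) π
        rw [hy]; constructor <;> linarith [h0.1, h0.2, h1.1, h1.2]
    · show squareDispersion 1 0 (L p) < 0
      rw [squareDispersion_one_zero_apply, hx, hy, Real.cos_add_cos]
      have e1 : (p 0 + p 1 + (p 0 - p 1)) / 2 = p 0 := by ring
      have e2 : (p 0 + p 1 - (p 0 - p 1)) / 2 = p 1 := by ring
      rw [e1, e2]
      have hc0 : 0 < cos (p 0) := Real.cos_pos_of_mem_Ioo h0
      have hc1 : 0 < cos (p 1) := Real.cos_pos_of_mem_Ioo h1
      nlinarith [mul_pos hc0 hc1]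
  have hvol : volume (L '' S) = ENNReal.ofReal (2 * π ^ 2) := by
    rw [Measure.addHaar_image_linearMap, det_shear, volume_halfOpenSquare,
      ← ENNReal.ofReal_mul (by norm_num)]
    norm_num
  have hle : ENNReal.ofReal (2 * π ^ 2) ≤
      volume (brillouinZone ∩ {p : Momentum | squareDispersion 1 0 p < 0}) :=
    hvol ▸ measure_mono hsub
  have hreal : 2 * π ^ 2 ≤
      (volume (brillouinZone ∩ {p : Momentum | squareDispersion 1 0 p < 0})).toReal := by
    have := ENNReal.toReal_mono (volume_fermiSea_lt_top 0).ne hle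
    rwa [ENNReal.toReal_ofReal (by positivity)] at this
  have hπ : 0 < (2 * π) ^ 2 := by positivity
  rw [lt_div_iff₀ hπ]
  nlinarith [Real.pi_pos]

/-! ### The chemical potential of a density -/

/-- For `0 < n < filling ε 0` there is `m ∈ (-4, 0)` with `filling ε m = n` (intermediate value
theorem on `[-4, 0]`). [folklore] -/
theorem exists_filling_eq {n : ℝ} (hn0 : 0 < n)
    (hn1 : n < KohnLuttinger.filling (squareDispersion 1 0) 0) :
    ∃ m ∈ Ioo (-4 : ℝ) 0, KohnLuttinger.filling (squareDispersion 1 0) m = n := by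
  have hivt := intermediate_value_Icc (show (-4 : ℝ) ≤ 0 by norm_num)
    continuous_filling.continuousOn
  rw [filling_of_le_neg_four le_rfl] at hivt
  obtain ⟨m, hm, hmn⟩ := hivt ⟨hn0.le, hn1.le⟩
  refine ⟨m, ⟨lt_of_le_of_ne hm.1 ?_, lt_of_le_of_ne hm.2 ?_⟩, hmn⟩
  · rintro rfl
    rw [filling_of_le_neg_four le_rfl] at hmn
    exact hn0.ne hmn
  · rintro rfl
    exact hn1.ne hmn.symm

/-- The `sInf` defining `chemicalPotentialOfDensity` is a genuine inverse: if `filling ε m = n`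
with `-4 ≤ m ≤ 4` and `0 < n`, then `{μ | n ≤ filling ε μ} = [m, ∞)` and `μ(n) = m`. [folklore] -/
theorem chemicalPotentialOfDensity_eq_of_filling_eq {n m : ℝ} (hn0 : 0 < n) (hm : m ∈ Icc (-4 : ℝ) 4)
    (hmn : KohnLuttinger.filling (squareDispersion 1 0) m = n) :
    chemicalPotentialOfDensity (squareDispersion 1 0) n = m := by
  unfold chemicalPotentialOfDensity
  have hset : {μ | n ≤ KohnLuttinger.filling (squareDispersion 1 0) μ} = Ici m := by
    ext μ
    simp only [mem_setOf_eq, mem_Ici]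
    constructor
    · intro h
      by_contra hlt
      have hlt : μ < m := lt_of_not_ge hlt
      rcases lt_or_ge μ (-4) with h4 | h4
      · rw [filling_of_le_neg_four h4.le] at h
        exact absurd h (not_le.2 hn0)
      · have := strictMonoOn_filling ⟨h4, hlt.le.trans hm.2⟩ hm hlt
        rw [hmn] at this
        exact absurd h (not_le.2 this)
    · intro h
      rw [← hmn]
      exact monotone_filling h
  rw [hset, csInf_Ici]

/-- **`μ(n)` realises the density**: for `0 < n < filling ε 0`,
`chemicalPotentialOfDensity ε n ∈ (-4, 0)` and `filling ε (chemicalPotentialOfDensity ε n) = n`.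
[folklore] -/
theorem chemicalPotentialOfDensity_spec {n : ℝ} (hn0 : 0 < n)
    (hn1 : n < KohnLuttinger.filling (squareDispersion 1 0) 0) :
    chemicalPotentialOfDensity (squareDispersion 1 0) n ∈ Ioo (-4 : ℝ) 0 ∧
      KohnLuttinger.filling (squareDispersion 1 0)
        (chemicalPotentialOfDensity (squareDispersion 1 0) n) = n := by
  obtain ⟨m, hm, hmn⟩ := exists_filling_eq hn0 hn1
  have heq := chemicalPotentialOfDensity_eq_of_filling_eq hn0 ⟨hm.1.le, by linarith [hm.2]⟩ hmn
  rw [heq]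
  exact ⟨hm, hmn⟩

/-- **Continuity of `n ↦ μ(n)`** on `(0, filling ε 0)` (the inverse of the continuous strictly
increasing filling). [folklore] -/
theorem continuousOn_chemicalPotentialOfDensity :
    ContinuousOn (chemicalPotentialOfDensity (squareDispersion 1 0))
      (Ioo 0 (KohnLuttinger.filling (squareDispersion 1 0) 0)) := by
  set F := KohnLuttinger.filling (squareDispersion 1 0) with hF
  rw [Metric.continuousOn_iff]
  intro n₀ hn₀ e he
  obtain ⟨hm₀, hFm₀⟩ := chemicalPotentialOfDensity_spec hn₀.1 hn₀.2
  set m₀ := chemicalPotentialOfDensity (squareDispersion 1 0) n₀ with hm₀def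
  -- a radius `e'` keeping `m₀ ± e'` inside the band `[-4, 4]`
  set e' : ℝ := min e (min (m₀ + 4) (4 - m₀)) / 2 with he'
  have he'pos : 0 < e' := by
    rw [he']
    have : 0 < min e (min (m₀ + 4) (4 - m₀)) :=
      lt_min he (lt_min (by linarith [hm₀.1]) (by linarith [hm₀.2]))
    linarith
  have he'le : e' < e := by
    rw [he']
    have := min_le_left e (min (m₀ + 4) (4 - m₀))
    linarith
  have he'1 : e' ≤ (m₀ + 4) / 2 := by
    rw [he']
    have := (min_le_right e (min (m₀ + 4) (4 - m₀))).trans (min_le_left _ _)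
    linarith
  have he'2 : e' ≤ (4 - m₀) / 2 := by
    rw [he']
    have := (min_le_right e (min (m₀ + 4) (4 - m₀))).trans (min_le_right _ _)
    linarith
  have hlo : m₀ - e' ∈ Icc (-4 : ℝ) 4 := ⟨by linarith, by linarith [hm₀.2]⟩
  have hhi : m₀ + e' ∈ Icc (-4 : ℝ) 4 := ⟨by linarith [hm₀.1], by linarith⟩
  have hmid : m₀ ∈ Icc (-4 : ℝ) 4 := ⟨hm₀.1.le, by linarith [hm₀.2]⟩
  have hlt1 : F (m₀ - e') < n₀ := by
    rw [← hFm₀]; exact strictMonoOn_filling hlo hmid (by linarith)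
  have hlt2 : n₀ < F (m₀ + e') := by
    rw [← hFm₀]; exact strictMonoOn_filling hmid hhi (by linarith)
  refine ⟨min (n₀ - F (m₀ - e')) (F (m₀ + e') - n₀), lt_min (by linarith) (by linarith), ?_⟩
  intro n hn hdist
  obtain ⟨hm, hFm⟩ := chemicalPotentialOfDensity_spec hn.1 hn.2
  set m := chemicalPotentialOfDensity (squareDispersion 1 0) n with hmdef
  rw [Real.dist_eq] at hdist ⊢
  have hd1 : F (m₀ - e') < n := by
    have := (abs_lt.1 hdist).1
    have := min_le_left (n₀ - F (m₀ - e')) (F (m₀ + e') - n₀)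
    linarith
  have hd2 : n < F (m₀ + e') := by
    have := (abs_lt.1 hdist).2
    have := min_le_right (n₀ - F (m₀ - e')) (F (m₀ + e') - n₀)
    linarith
  have h1 : m₀ - e' < m := by
    by_contra hle
    have hle : m ≤ m₀ - e' := not_lt.1 hle
    have := monotone_filling hle
    rw [hFm] at this
    linarith
  have h2 : m < m₀ + e' := by
    by_contra hle
    have hle : m₀ + e' ≤ m := not_lt.1 hle
    have := monotone_filling hle
    rw [hFm] at this
    linarith
  rw [abs_lt]
  constructor <;> linarith

/-- On the doping window `δ ∈ [1/4, 12/25]` the density `1 - δ ∈ [13/25, 3/4]` lies in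
`(0, filling ε 0)`. [folklore] -/
theorem one_sub_mem_Ioo_of_mem_window {δ : ℝ} (hδ : δ ∈ Icc (1 / 4 : ℝ) (12 / 25)) :
    1 - δ ∈ Ioo 0 (KohnLuttinger.filling (squareDispersion 1 0) 0) :=
  ⟨by linarith [hδ.2], by linarith [hδ.1, three_div_four_lt_filling_zero]⟩

/-- On the doping window the chemical potential `μ(1 - δ)` lies in the open band interval
`(-4, 0)` (no van Hove level, Fermi curve closed around `Γ`). [folklore] -/
theorem chemicalPotentialOfDensity_window_mem_Ioo {δ : ℝ} (hδ : δ ∈ Icc (1 / 4 : ℝ) (12 / 25)) :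
    chemicalPotentialOfDensity (squareDispersion 1 0) (1 - δ) ∈ Ioo (-4 : ℝ) 0 :=
  (chemicalPotentialOfDensity_spec (one_sub_mem_Ioo_of_mem_window hδ).1
    (one_sub_mem_Ioo_of_mem_window hδ).2).1

/-- `δ ↦ μ(1 - δ)` is continuous on the doping window. [folklore] -/
theorem continuousOn_chemicalPotentialOfDensity_window :
    ContinuousOn (fun δ : ℝ => chemicalPotentialOfDensity (squareDispersion 1 0) (1 - δ))
      (Icc (1 / 4 : ℝ) (12 / 25)) :=
  continuousOn_chemicalPotentialOfDensity.comp (continuous_const.sub continuous_id).continuousOn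
    fun _ hδ => one_sub_mem_Ioo_of_mem_window hδ

/-! ### Reduction of the item to `μ`-continuity of the channel bottom -/

/-- **Reduction.** `CwChannelInfContinuous` (continuity of `δ ↦ channelInf ε (μ(1-δ)) U χ` on
`[1/4, 12/25]`) follows from continuity of `μ ↦ channelInf ε μ U χ` on the band interval
`(-4, 0)`, by composition with the continuous map `δ ↦ μ(1 - δ) ∈ (-4, 0)`. [folklore] -/
theorem cwChannelInfContinuous_of_continuousOn
    (h : ∀ (U : ℝ) (χ : D4Irrep),
      ContinuousOn (fun μ : ℝ => channelInf (squareDispersion 1 0) μ U χ) (Ioo (-4 : ℝ) 0)) :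
    Summit.HubbardSuperconductivity.HubbardSuperconductivity.Theses.ChiralWindow.CwChannelInfContinuous := by
  intro U χ
  exact (h U χ).comp continuousOn_chemicalPotentialOfDensity_window
    fun _ hδ => chemicalPotentialOfDensity_window_mem_Ioo hδ

end Summit.HubbardSuperconductivity.HubbardSuperconductivity.Theorems

end
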